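import Mathlib

/-!
# SoloBlindWeilGammaLadder — the Γ-bookkeeping of THEOREM V_∞ (solo-blind by-product, s62)

For the hyperelliptic family `y² = x ∏_{j ≤ g} (x² − a_j²)` THEOREM V_∞ (HOME `paper/weil-det.md` §10)
evaluates the even/odd gap-period determinants in every genus.  Its analytic part ends in the
recursion `X̃₁(g) = (−1)^{g+1} B′_g X̃₁(g−1)`, `X̃₂(g) = (−1)^g B″_g X̃₂(g−1)`, `X̃₁(0) = X̃₂(0) = 1`, with
the Beta steps `B′_m = (√π/2) Γ((2m−1)/4)/Γ((2m+1)/4)` and `B″_m = (√π/2) Γ((2m+1)/4)/Γ((2m+3)/4)`.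
This file certifies the remaining bookkeeping, which is pure Γ-algebra:

* the closed forms `X1c g = (−1)^{g(g+3)/2} (√π/2)^g Γ(1/4)/Γ(g/2+1/4)` and
  `X2c g = (−1)^{g(g+1)/2} (√π/2)^g Γ(3/4)/Γ(g/2+3/4)` satisfy that recursion with initial value `1`
  (`X1c_zero`, `X1c_succ`, `X2c_zero`, `X2c_succ`), hence ARE the determinant values;
* they reproduce the table of PROPOSITION V_g: `X1c (2n) = (−1)^n π^n/∏_{i<n}(4i+1)`,
  `X1c (2n+1) = (−1)^n π^n Ω_E/∏_{i<n}(4i+3)`, `X2c (2n) = (−1)^n π^n/∏_{i<n}(4i+3)`,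
  `X2c (2n+1) = (−1)^{n+1} π^{n+1}/(Ω_E ∏_{i<n}(4i+5))` with `Ω_E = Γ(1/4)²/(2√(2π))`
  (`X1c_even`, `X1c_odd`, `X2c_even`, `X2c_odd`, `OmegaE_eq`);
* the product `X1c g · X2c g = (−1)^g π^g/(2g−1)!!` (`X1c_mul_X2c`), i.e. `D_even·D_odd`, by the
  telescoping `B′_{m} B″_{m} = π/(2m−1)` — no duplication formula needed.

Inputs: `Real.Gamma_add_one`, the reflection formula at `1/4`.  Bearing on the summit statement: none
(by-product line; the summit is `Literature.Periods.KZPeriodConjecture`).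
-/

namespace Summit.KontsevichZagierPeriods.KontsevichZagierPeriods.Theorems
namespace SoloBlind.WeilGammaLadder

open Real Finset

/-- Even Beta step, indexed from `0`: `Bp m = B′_{m+1} = (√π/2) Γ((2m+1)/4) / Γ((2m+3)/4)`. -/
noncomputable def Bp (m : ℕ) : ℝ := sqrt π / 2 * Gamma ((2 * m + 1) / 4) / Gamma ((2 * m + 3) / 4)

/-- Odd Beta step, indexed from `0`: `Bpp m = B″_{m+1} = (√π/2) Γ((2m+3)/4) / Γ((2m+5)/4)`. -/
noncomputable def Bpp (m : ℕ) : ℝ := sqrt π / 2 * Gamma ((2 * m + 3) / 4) / Gamma ((2 * m + 5) / 4)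

/-- Closed form of `√Π · D_even` in genus `g`. -/
noncomputable def X1c (g : ℕ) : ℝ :=
  (-1) ^ (g * (g + 3) / 2) * (sqrt π / 2) ^ g * Gamma (1 / 4) / Gamma (g / 2 + 1 / 4)

/-- Closed form of `D_odd / √Π` in genus `g`. -/
noncomputable def X2c (g : ℕ) : ℝ :=
  (-1) ^ (g * (g + 1) / 2) * (sqrt π / 2) ^ g * Gamma (3 / 4) / Gamma (g / 2 + 3 / 4)

/-- The lemniscatic period `Ω_E = Γ(1/4)² / (2 √(2π))` of `y² = x³ − x`. -/
noncomputable def OmegaE : ℝ := Gamma (1 / 4) ^ 2 / (2 * sqrt (2 * π))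

/-- `Γ` is positive at the positive arguments used here. -/
theorem Gamma_pos' {s : ℝ} (hs : 0 < s) : 0 < Gamma s := Gamma_pos_of_pos hs

/-- The Γ-ladder: `Γ(n + a) = Γ(a) ∏_{i<n} (i + a)` for `a > 0`. -/
theorem Gamma_ladder (a : ℝ) (ha : 0 < a) (n : ℕ) :
    Gamma (n + a) = Gamma a * ∏ i ∈ range n, ((i : ℝ) + a) := by
  induction n with
  | zero => simp
  | succ n ih =>
    have hna : (n : ℝ) + a ≠ 0 := by positivity
    rw [prod_range_succ, show ((n + 1 : ℕ) : ℝ) + a = (n + a) + 1 by push_cast; ring,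
      Gamma_add_one hna, ih]
    ring

/-- `∏_{i<n} (4 i + c) = 4^n ∏_{i<n} (i + c/4)`. -/
theorem prod_four (n : ℕ) (c : ℝ) :
    ∏ i ∈ range n, (4 * (i : ℝ) + c) = 4 ^ n * ∏ i ∈ range n, ((i : ℝ) + c / 4) := by
  induction n with
  | zero => simp
  | succ n ih => rw [prod_range_succ, prod_range_succ, ih]; ring

/-- `(√π/2)^(2n) = (π/4)^n`. -/
theorem sqrt_pi_half_pow_two_mul (n : ℕ) : (sqrt π / 2) ^ (2 * n) = (π / 4) ^ n := by
  rw [pow_mul, div_pow, sq_sqrt pi_pos.le]; norm_num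

/-! ## The recursion with initial value 1 -/

/-- `X̃₁(0) = 1`. -/
theorem X1c_zero : X1c 0 = 1 := by
  have h := (Gamma_pos' (s := 1 / 4) (by norm_num)).ne'
  have h' : Gamma ((4 : ℝ)⁻¹) ≠ 0 := by rw [← one_div]; exact h
  simp [X1c, h']

/-- `X̃₂(0) = 1`. -/
theorem X2c_zero : X2c 0 = 1 := by
  have h := (Gamma_pos' (s := 3 / 4) (by norm_num)).ne'
  simp [X2c, h]

/-- Sign step for the even block: `(−1)^{(g+1)(g+4)/2} = (−1)^{g+2} (−1)^{g(g+3)/2}`. -/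
theorem sign1_succ (g : ℕ) :
    ((-1 : ℝ)) ^ ((g + 1) * (g + 1 + 3) / 2) = (-1) ^ (g + 2) * (-1) ^ (g * (g + 3) / 2) := by
  rw [show (g + 1) * (g + 1 + 3) = g * (g + 3) + 2 * (g + 2) by ring,
    Nat.add_mul_div_left _ _ (by norm_num : 0 < 2), pow_add, mul_comm]

/-- Sign step for the odd block: `(−1)^{(g+1)(g+2)/2} = (−1)^{g+1} (−1)^{g(g+1)/2}`. -/
theorem sign2_succ (g : ℕ) :
    ((-1 : ℝ)) ^ ((g + 1) * (g + 1 + 1) / 2) = (-1) ^ (g + 1) * (-1) ^ (g * (g + 1) / 2) := by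
  rw [show (g + 1) * (g + 1 + 1) = g * (g + 1) + 2 * (g + 1) by ring,
    Nat.add_mul_div_left _ _ (by norm_num : 0 < 2), pow_add, mul_comm]

/-- The even recursion of THEOREM V_∞ (B4): `X̃₁(g+1) = (−1)^{g+2} B′_{g+1} X̃₁(g)`. -/
theorem X1c_succ (g : ℕ) : X1c (g + 1) = (-1) ^ (g + 2) * Bp g * X1c g := by
  have h1 : Gamma ((2 * (g : ℝ) + 1) / 4) ≠ 0 := (Gamma_pos' (by positivity)).ne'
  have h2 : Gamma ((2 * (g : ℝ) + 3) / 4) ≠ 0 := (Gamma_pos' (by positivity)).ne'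
  unfold X1c Bp
  rw [sign1_succ, show ((g + 1 : ℕ) : ℝ) / 2 + 1 / 4 = (2 * g + 3) / 4 by push_cast; ring,
    show (g : ℝ) / 2 + 1 / 4 = (2 * g + 1) / 4 by ring]
  field_simp
  ring

/-- The odd recursion of THEOREM V_∞ (B4): `X̃₂(g+1) = (−1)^{g+1} B″_{g+1} X̃₂(g)`. -/
theorem X2c_succ (g : ℕ) : X2c (g + 1) = (-1) ^ (g + 1) * Bpp g * X2c g := by
  have h1 : Gamma ((2 * (g : ℝ) + 3) / 4) ≠ 0 := (Gamma_pos' (by positivity)).ne'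
  have h2 : Gamma ((2 * (g : ℝ) + 5) / 4) ≠ 0 := (Gamma_pos' (by positivity)).ne'
  unfold X2c Bpp
  rw [sign2_succ, show ((g + 1 : ℕ) : ℝ) / 2 + 3 / 4 = (2 * g + 5) / 4 by push_cast; ring,
    show (g : ℝ) / 2 + 3 / 4 = (2 * g + 3) / 4 by ring]
  field_simp
  ring

/-! ## The product `D_even · D_odd` -/

/-- The Beta steps telescope in pairs: `B′_{m+1} B″_{m+1} = π/(2m+1)`. -/
theorem Bp_mul_Bpp (m : ℕ) : Bp m * Bpp m = π / (2 * m + 1) := by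
  have h1 : Gamma ((2 * (m : ℝ) + 1) / 4) ≠ 0 := (Gamma_pos' (by positivity)).ne'
  have h3 : Gamma ((2 * (m : ℝ) + 3) / 4) ≠ 0 := (Gamma_pos' (by positivity)).ne'
  have hq : (2 * (m : ℝ) + 1) / 4 ≠ 0 := by positivity
  have h5 : Gamma ((2 * (m : ℝ) + 5) / 4) = (2 * m + 1) / 4 * Gamma ((2 * m + 1) / 4) := by
    rw [show (2 * (m : ℝ) + 5) / 4 = (2 * m + 1) / 4 + 1 by ring, Gamma_add_one hq]
  unfold Bp Bpp
  rw [h5]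
  field_simp
  rw [sq_sqrt pi_pos.le]; ring

/-- `X̃₁(g) X̃₂(g) = (−1)^g π^g / (2g−1)!!`, i.e. `D_even · D_odd = (−1)^g π^g/(2g−1)!!`. -/
theorem X1c_mul_X2c (g : ℕ) : X1c g * X2c g = (-1) ^ g * π ^ g / ((2 * g - 1).doubleFactorial : ℕ) := by
  induction g with
  | zero => simp [X1c_zero, X2c_zero]
  | succ g ih =>
    have hB := Bp_mul_Bpp g
    have hd : ((2 * (g + 1) - 1).doubleFactorial : ℕ) = (2 * g + 1) * ((2 * g - 1).doubleFactorial : ℕ) := by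
      rw [show 2 * (g + 1) - 1 = 2 * g + 1 by omega]; exact Nat.doubleFactorial_add_one (2 * g)
    have hpos : (0 : ℝ) < ((2 * g - 1).doubleFactorial : ℕ) := by
      exact_mod_cast Nat.doubleFactorial_pos _
    have hs : ((-1 : ℝ) ^ (g + 2) * (-1) ^ (g + 1)) = -1 := by
      rw [← pow_add, show g + 2 + (g + 1) = 2 * (g + 1) + 1 by ring, pow_succ, pow_mul]; norm_num
    rw [X1c_succ, X2c_succ, show (-1 : ℝ) ^ (g + 2) * Bp g * X1c g * ((-1) ^ (g + 1) * Bpp g * X2c g)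
      = ((-1) ^ (g + 2) * (-1) ^ (g + 1)) * (Bp g * Bpp g) * (X1c g * X2c g) by ring, hs, hB, ih, hd]
    push_cast
    field_simp
    ring

/-! ## The table of PROPOSITION V_g -/

/-- `(−1)^{(2n)(2n+3)/2} = (−1)^n`. -/
theorem sign1_even (n : ℕ) : ((-1 : ℝ)) ^ (2 * n * (2 * n + 3) / 2) = (-1) ^ n := by
  rw [show 2 * n * (2 * n + 3) = 2 * (n * (2 * n + 3)) by ring, Nat.mul_div_cancel_left _ two_pos,
    show n * (2 * n + 3) = 2 * (n * (n + 1)) + n by ring, pow_add, pow_mul]; norm_num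

/-- `(−1)^{(2n+1)(2n+4)/2} = (−1)^n`. -/
theorem sign1_odd (n : ℕ) : ((-1 : ℝ)) ^ ((2 * n + 1) * (2 * n + 1 + 3) / 2) = (-1) ^ n := by
  rw [show (2 * n + 1) * (2 * n + 1 + 3) = 2 * ((2 * n + 1) * (n + 2)) by ring,
    Nat.mul_div_cancel_left _ two_pos, show (2 * n + 1) * (n + 2) = 2 * ((n + 1) ^ 2) + n by ring,
    pow_add, pow_mul]; norm_num

/-- `(−1)^{(2n)(2n+1)/2} = (−1)^n`. -/
theorem sign2_even (n : ℕ) : ((-1 : ℝ)) ^ (2 * n * (2 * n + 1) / 2) = (-1) ^ n := by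
  rw [show 2 * n * (2 * n + 1) = 2 * (n * (2 * n + 1)) by ring, Nat.mul_div_cancel_left _ two_pos,
    show n * (2 * n + 1) = 2 * (n * n) + n by ring, pow_add, pow_mul]; norm_num

/-- `(−1)^{(2n+1)(2n+2)/2} = (−1)^{n+1}`. -/
theorem sign2_odd (n : ℕ) : ((-1 : ℝ)) ^ ((2 * n + 1) * (2 * n + 1 + 1) / 2) = (-1) ^ (n + 1) := by
  rw [show (2 * n + 1) * (2 * n + 1 + 1) = 2 * ((2 * n + 1) * (n + 1)) by ring,
    Nat.mul_div_cancel_left _ two_pos, show (2 * n + 1) * (n + 1) = 2 * (n * (n + 1)) + (n + 1) by ring,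
    pow_add, pow_mul]; norm_num

/-- Even genus, even block: `X̃₁(2n) = (−1)^n π^n / ∏_{i<n} (4i+1)` (`P_{g−1}` for `g = 2n`). -/
theorem X1c_even (n : ℕ) : X1c (2 * n) = (-1) ^ n * π ^ n / ∏ i ∈ range n, (4 * (i : ℝ) + 1) := by
  have hG := Gamma_ladder (1 / 4) (by norm_num) n
  have hG0 : Gamma (1 / 4 : ℝ) ≠ 0 := (Gamma_pos' (by norm_num)).ne'
  have hP : (0 : ℝ) < ∏ i ∈ range n, ((i : ℝ) + 1 / 4) := prod_pos fun i _ => by positivity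
  unfold X1c
  rw [sign1_even, show ((2 * n : ℕ) : ℝ) / 2 + 1 / 4 = n + 1 / 4 by push_cast; ring, hG,
    sqrt_pi_half_pow_two_mul, prod_four, div_pow]
  field_simp

/-- Even genus, odd block: `X̃₂(2n) = (−1)^n π^n / ∏_{i<n} (4i+3)` (`P_g` for `g = 2n`). -/
theorem X2c_even (n : ℕ) : X2c (2 * n) = (-1) ^ n * π ^ n / ∏ i ∈ range n, (4 * (i : ℝ) + 3) := by
  have hG := Gamma_ladder (3 / 4) (by norm_num) n
  have hG0 : Gamma (3 / 4 : ℝ) ≠ 0 := (Gamma_pos' (by norm_num)).ne'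
  have hP : (0 : ℝ) < ∏ i ∈ range n, ((i : ℝ) + 3 / 4) := prod_pos fun i _ => by positivity
  unfold X2c
  rw [sign2_even, show ((2 * n : ℕ) : ℝ) / 2 + 3 / 4 = n + 3 / 4 by push_cast; ring, hG,
    sqrt_pi_half_pow_two_mul, prod_four, div_pow]
  field_simp

/-- The reflection formula at `1/4`: `Γ(1/4) Γ(3/4) = π √2`. -/
theorem Gamma_quarter_mul_three_quarter : Gamma (1 / 4) * Gamma (3 / 4) = π * sqrt 2 := by
  have h := Gamma_mul_Gamma_one_sub (1 / 4 : ℝ)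
  rw [show (1 : ℝ) - 1 / 4 = 3 / 4 by norm_num, show π * (1 / 4 : ℝ) = π / 4 by ring,
    sin_pi_div_four] at h
  rw [h]
  have h2 : sqrt 2 ≠ 0 := by positivity
  field_simp
  rw [show sqrt 2 ^ 2 = 2 from sq_sqrt (by norm_num)]

/-- `Ω_E = (√π/2) Γ(1/4)/Γ(3/4)` (the even step `B′_1`). -/
theorem OmegaE_eq : sqrt π / 2 * Gamma (1 / 4) / Gamma (3 / 4) = OmegaE := by
  have h34 : Gamma (3 / 4 : ℝ) ≠ 0 := (Gamma_pos' (by norm_num)).ne'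
  have hr := Gamma_quarter_mul_three_quarter
  have hs2 : sqrt (2 * π) = sqrt 2 * sqrt π := sqrt_mul (by norm_num) π
  have hp : sqrt π * sqrt π = π := mul_self_sqrt pi_pos.le
  have hden : (2 * (sqrt 2 * sqrt π)) ≠ 0 := by positivity
  unfold OmegaE
  rw [hs2, div_eq_div_iff h34 hden]
  linear_combination (Gamma (1 / 4) * sqrt 2) * hp - Gamma (1 / 4) * hr

/-- `π/Ω_E = (√π/2) Γ(3/4)/Γ(5/4)` (the odd step `B″_1`). -/
theorem pi_div_OmegaE_eq : sqrt π / 2 * Gamma (3 / 4) / Gamma (5 / 4) = π / OmegaE := by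
  have h14 : Gamma (1 / 4 : ℝ) ≠ 0 := (Gamma_pos' (by norm_num)).ne'
  have h34 : Gamma (3 / 4 : ℝ) ≠ 0 := (Gamma_pos' (by norm_num)).ne'
  have hsp : 0 < sqrt π := sqrt_pos.mpr pi_pos
  have hp : sqrt π * sqrt π = π := mul_self_sqrt pi_pos.le
  have h54 : Gamma (5 / 4 : ℝ) = 1 / 4 * Gamma (1 / 4) := by
    rw [show (5 / 4 : ℝ) = 1 / 4 + 1 by norm_num, Gamma_add_one (by norm_num)]
  have hd : sqrt π / 2 * Gamma (1 / 4) / Gamma (3 / 4) ≠ 0 :=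
    div_ne_zero (mul_ne_zero (by positivity) h14) h34
  rw [← OmegaE_eq, h54, div_eq_div_iff (mul_ne_zero (by norm_num) h14) hd,
    show sqrt π / 2 * Gamma (3 / 4) * (sqrt π / 2 * Gamma (1 / 4) / Gamma (3 / 4))
      = (sqrt π * sqrt π) * Gamma (1 / 4) / 4 by field_simp; norm_num, hp]
  ring

/-- Odd genus, even block: `X̃₁(2n+1) = (−1)^n π^n Ω_E / ∏_{i<n} (4i+3)` (`P_{g−1}` for `g = 2n+1`). -/
theorem X1c_odd (n : ℕ) :
    X1c (2 * n + 1) = (-1) ^ n * π ^ n * OmegaE / ∏ i ∈ range n, (4 * (i : ℝ) + 3) := by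
  have hG := Gamma_ladder (3 / 4) (by norm_num) n
  have hG0 : Gamma (3 / 4 : ℝ) ≠ 0 := (Gamma_pos' (by norm_num)).ne'
  have hP : (0 : ℝ) < ∏ i ∈ range n, ((i : ℝ) + 3 / 4) := prod_pos fun i _ => by positivity
  unfold X1c
  rw [sign1_odd, show ((2 * n + 1 : ℕ) : ℝ) / 2 + 1 / 4 = n + 3 / 4 by push_cast; ring, hG,
    show (sqrt π / 2) ^ (2 * n + 1) = (π / 4) ^ n * (sqrt π / 2) by
      rw [pow_succ, sqrt_pi_half_pow_two_mul], prod_four, ← OmegaE_eq, div_pow]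
  field_simp

/-- Odd genus, odd block: `X̃₂(2n+1) = (−1)^{n+1} π^{n+1} / (Ω_E ∏_{i<n} (4i+5))` (`P_g` for `g = 2n+1`). -/
theorem X2c_odd (n : ℕ) :
    X2c (2 * n + 1) = (-1) ^ (n + 1) * π ^ (n + 1) / (OmegaE * ∏ i ∈ range n, (4 * (i : ℝ) + 5)) := by
  have hG := Gamma_ladder (5 / 4) (by norm_num) n
  have hG0 : Gamma (5 / 4 : ℝ) ≠ 0 := (Gamma_pos' (by norm_num)).ne'
  have h14 : Gamma (1 / 4 : ℝ) ≠ 0 := (Gamma_pos' (by norm_num)).ne'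
  have hO : OmegaE ≠ 0 := by unfold OmegaE; exact div_ne_zero (pow_ne_zero _ h14) (by positivity)
  have hP : (0 : ℝ) < ∏ i ∈ range n, ((i : ℝ) + 5 / 4) := prod_pos fun i _ => by positivity
  have key : sqrt π / 2 * Gamma (3 / 4) = π / OmegaE * Gamma (5 / 4) := by
    rw [← pi_div_OmegaE_eq]; field_simp
  unfold X2c
  rw [sign2_odd, show ((2 * n + 1 : ℕ) : ℝ) / 2 + 3 / 4 = n + 5 / 4 by push_cast; ring, hG,
    show (sqrt π / 2) ^ (2 * n + 1) = (π / 4) ^ n * (sqrt π / 2) by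
      rw [pow_succ, sqrt_pi_half_pow_two_mul], prod_four,
    show (-1 : ℝ) ^ (n + 1) * ((π / 4) ^ n * (sqrt π / 2)) * Gamma (3 / 4)
      = (-1) ^ (n + 1) * (π / 4) ^ n * (sqrt π / 2 * Gamma (3 / 4)) by ring, key, div_pow]
  field_simp
  ring

/-- Sanity instance `g = 3`: `X̃₁(3) = −π Ω_E/3`, `X̃₂(3) = π²/(5 Ω_E)` — the values of #246/#247. -/
example : X1c 3 = -(π * OmegaE) / 3 ∧ X2c 3 = π ^ 2 / (OmegaE * 5) := by
  refine ⟨?_, ?_⟩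
  · have h : X1c (2 * 1 + 1) = _ := X1c_odd 1
    simp only [prod_range_succ, prod_range_zero, Nat.cast_zero, mul_zero, zero_add, one_mul,
      pow_one] at h
    refine (h : X1c 3 = _).trans ?_
    ring
  · have h : X2c (2 * 1 + 1) = _ := X2c_odd 1
    simp only [prod_range_succ, prod_range_zero, Nat.cast_zero, mul_zero, zero_add, one_mul] at h
    refine (h : X2c 3 = _).trans ?_
    ring

end SoloBlind.WeilGammaLadder
end Summit.KontsevichZagierPeriods.KontsevichZagierPeriods.Theorems
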